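import Summits.QuantumFields.YangMills.Theorems.FluctuationComparisonRegPrIntLOrganTangentFibreWeightSquareIntegrability
import Summits.QuantumFields.YangMills.Theorems.FluctuationComparisonRegPrIntLOrganTangentNearStability
import HarnessLib

/-!
# Crux `FluctuationComparisonRegPrIntL` (stmt-QuantumFields-20520, rung R3), PATH-B organ, JENSEN SIDE — DISCHARGE SPEC v1.4 §9 «sq» PROGRAMME: «JV0-sq» —
# THE (JV0-h)sq CONJUNCT OF `SpreadFibreLawHJsq` from the frame, the chart block [8]–[9] and PAIR-LOCAL CORNER STABILITY (the sq edition of ✓p816800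
# `…OrganTangentJV0OfWindowDisplacement.jv0Clause_of_windowDisplacement`: the window-to-window letter `Dw`∕`hglob` + room REPLACED by the pair-local
# stability letter of ✓p815882 at the corner pairs of one admissible square — «near pairs only»), DEFINITION-FREE

Cell `ym3-torus` (rung R3 = continuum `SU(2)` Yang–Mills on T³ — NOT d = 4, NOT infinite volume, NOT a mass gap, NOT Clay), width copy `ym3-torus-px5` (gen 21; LEAD
`ym-ust-20520-w3` g26 №38∕№40, SPEC v1.4 §9; w4 g24 (sq1) `SpreadFibreLawHJsq` 3a14fcb8, TN-HGLOB-FRAME §6; px20 g21 «`hdisp`-chaining» ∕ «near stability» bricks;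
px19 g21 (B′) and w5 g24 (L32)∕(L34) — the sq-knit's ONE stability currency «pair-local `hstab` at (value, law)»).  `--kind proof --supports stmt-QuantumFields-20520
--as helper`, count-neutral, DEF-FREE, default heartbeats, `autoImplicit false`; no registry ∕ binder ∕ `Lines/` edit.

WHAT.  ★★`jv0ClauseSq_of_cornerStability`: for the organ frame's level-`Ts` densities (measurable; continuous and positive on the `θ_Ts`-window), the multi-window cut
(the four ✓`exists_height_multiWindowWeight` facts on the reviewed `mwCut`), a fibred chart's data `(τ, Φ, J)` (`τ` probability, `Φ J` measurable, `J ≤ CJ` [8], positive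
good-set mass [9]) — ALL BINDERS VERBATIM from ✓p816800 — and, in place of ✓p816800's window-to-window clause `hglob` + room, the PAIR-LOCAL corner-stability text
`hstabSq`: for every admissible coarse square `(U, V = U^{B,m}, W = U^{B′,m′}, Y = V^{B′,m′})` (`‖m‖, ‖m′‖ ≤ rc·θ_j∕4`, corners in the `θ_j∕4`-window) and every two
corners `X`, `Xw` of it (spelled `X = U ∨ X = V ∨ X = W ∨ X = Y`, `Xw = …` — the (JV0-h)sq prefix of `SpreadFibreLawHJsq` CHARACTER FOR CHARACTER), «`mwCut (Φ (Xw, z)) ≠ 0`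
puts every fine plaquette of `Φ (X, z)` in the `cS·θBal_Ts`-window», `cS < 1` (= ✓p815882's `hstab` letter = px19 (B′)'s `hstabX` = w5 (L32)'s `hstab`; produced per corner
pair from the row-sq's one-bond displacement clause `hdisp` by px20 g21's `hstab_corners_of_hdisp`) — the conclusion is the (JV0-h)sq conjunct TEXT of `SpreadFibreLawHJsq`
CHARACTER FOR CHARACTER: `∀ t ∈ [0,1], ∀ square, ∀ corners X Xw, Integrable ŵ_t(Xw) ∧ ∫ ŵ_t(Xw) = 1 ∧ Integrable (h∘Φ(X,·)·ŵ_t(Xw)) ∧ Integrable ((h∘Φ(X,·))²·ŵ_t(Xw))`.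
Composition of ✓p814778 `wgt_normalised` (the law half, at ANY window point) and ✓p815882 `integrable_logRatio_mul_wgt_of_squareStability` (the square-integrability half)
— ✓p816800's proof with its five-line `hstab` derivation from `hglob` deleted.  The knit-sq's (JV0-h)sq line: `exact jv0ClauseSq_of_cornerStability F γ b₀ p₀ j Ts hjTs ρ ρ′
hρm hρ′m hcT hcT′ hposT hθT hθj hχc hχ0 hχsupp hχpos τ Φ J hΦm hJm CJ hJle hpos rc c hc ⟨corner stability from `hdisp`⟩`, and its output `hJV0` is what ✓p819216
`jv1ClauseSq_of_covKernel_profiles` eats as `hJV0`.  §2 ★★`jv0ClauseSq_of_hdisp` composes the corner-stability hypothesis away: it takes the (I-geo) one-bond displacement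
clause `hdisp` of `OrganDischargeInputsHJ` (✓p818968) VERBATIM with its cap `DP ≤ Db` and px20 g21's room₃ `24∕25·θBal_Ts + 3·(Db·rc) ≤ c·θBal_Ts` and calls ✓p819252
`…OrganTangentNearStability.hstab_corners_of_hdisp` once — the knit-sq's (JV0-h)sq line becomes ONE name over row-sq letters only:
`jv0ClauseSq_of_hdisp F γ b₀ p₀ j Ts hjTs ρ ρ′ … hpos c Db rc hc hrc0 hDb0 DP hcap hdisp hroom3`.

HONEST FRAMING: bookkeeping ([folklore]); the corner-stability text is a HYPOTHESIS, not a result; nothing of Bałaban's analysis is asserted or proved ([Balaban1985Variational]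
Thm 1 (9)–(10) is where one-bond displacement control would come from — LOCATE only); `SpreadFibreLawH(J)`, `SpreadFibreLawHJsq`, `OrganDischargeInputsHJ(sq)` remain
HYPOTHESIS rows; JVAR″, JEN″, LIN″, O1ᵘ-H v2.2, S1aᴴ, S3ᴴ, S2α′, S2β, 26243, the five registered stubs, crux 20520 and `YM3TorusSU2` are NOT proved; registry
`Lines/semiclassical_s2beta.lean` ∕ `Lines/runpair_organ.lean` untouched, nothing here is registered; rung R3 = SU(2) YM₃ on T³ at fixed lattice data — NOT d = 4, NOT
infinite volume, NOT a mass gap, NOT Clay; the Yang–Mills mass gap is NOT proved.  Credit: LEAD w3 g26 (✓p816800, SPEC), w4 g24 ((sq1) text), px20 g21 ∕ px19 g21 ∕ w5 g24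
(the pair-local currency).
-/

set_option autoImplicit false

noncomputable section

namespace Summit.QuantumFields.YangMills.Theorems.OrganTangentJV0OfCornerStability

open MeasureTheory Filter Topology
open scoped ENNReal NNReal
open Literature.MathematicalPhysics.QuantumFieldTheory.Balaban1983to89 T3ContinuumYM3Torus T3NestedUnitLaws
  T3UnitLawDensityEML T4Continuum T3UnitScaleTilt T3LevelShift T3TiltDescent
open T4CubeChartExp (expPt)
open Summit.QuantumFields.YangMills.Theorems.FluctuationComparisonRegPrIntLRunpairOrganFibreLaw (mwCut wNum wgt)
open Summit.QuantumFields.YangMills.Theorems.OrganTangentFibreWeightNormalisation (wgt_normalised)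
open Summit.QuantumFields.YangMills.Theorems.OrganTangentFibreWeightSquareIntegrability (integrable_logRatio_mul_wgt_of_squareStability)
open Summit.QuantumFields.YangMills.Theorems.OrganTangentNearStability (hstab_corners_of_hdisp)
open Set (Icc)
open Function (update)

/-- ★★ **JV0-sq** — the (JV0-h)sq conjunct of `SpreadFibreLawHJsq` (text character-exact) from the frame, the chart block [8]–[9] and PAIR-LOCAL corner stability at the
corner pairs of one admissible square, `cS < 1` (module docstring). [folklore] -/
theorem jv0ClauseSq_of_cornerStability (F : T3Family) (γ b₀ p₀ : ℝ) (j Ts : ℕ) (hjTs : j + 1 ≤ Ts)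
    (ρ ρ' : (i : ℕ) → GaugeField (F.P i) 0 ↥(Matrix.specialUnitaryGroup (Fin 2) ℂ) → ℝ)
    (hρm : Measurable (ρ Ts)) (hρ'm : Measurable (ρ' Ts))
    (hρc : ContinuousOn (ρ Ts) {U | PlaqSmall (θBal F.L γ b₀ p₀ Ts) U}) (hρ'c : ContinuousOn (ρ' Ts) {U | PlaqSmall (θBal F.L γ b₀ p₀ Ts) U})
    (hρpos : ∀ U, PlaqSmall (θBal F.L γ b₀ p₀ Ts) U → 0 < ρ Ts U ∧ 0 < ρ' Ts U)
    (hθ : 0 < θBal F.L γ b₀ p₀ Ts) (hθj : 0 < θBal F.L γ b₀ p₀ j)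
    (hχc : Continuous (mwCut F γ b₀ p₀ j Ts)) (hχ0 : ∀ U, 0 ≤ mwCut F γ b₀ p₀ j Ts U)
    (hχsupp : ∀ U, mwCut F γ b₀ p₀ j Ts U ≠ 0 → ∀ (n : ℕ) (hjn : j + 1 ≤ n) (hnK : n ≤ Ts), PlaqSmall (24 / 25 * θBal F.L γ b₀ p₀ n) (descendTo F ℰp n Ts hnK U))
    (hχpos : ∀ U, (∀ (n : ℕ) (hjn : j + 1 ≤ n) (hnK : n ≤ Ts), PlaqSmall (24 / 25 * θBal F.L γ b₀ p₀ n) (descendTo F ℰp n Ts hnK U)) → 0 < mwCut F γ b₀ p₀ j Ts U)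
    {Z : Type} [MeasurableSpace Z] (τ : Measure Z) [IsProbabilityMeasure τ]
    (Φ : GaugeField (F.P j) 0 ↥(Matrix.specialUnitaryGroup (Fin 2) ℂ) × Z → GaugeField (F.P Ts) 0 ↥(Matrix.specialUnitaryGroup (Fin 2) ℂ))
    (J : GaugeField (F.P j) 0 ↥(Matrix.specialUnitaryGroup (Fin 2) ℂ) × Z → ℝ≥0)
    (hΦm : Measurable Φ) (hJm : Measurable J) (CJ : ℝ) (hJle : ∀ V z, (J (V, z) : ℝ) ≤ CJ)
    (hpos : ∀ V, PlaqSmall (θBal F.L γ b₀ p₀ j) V →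
      0 < ∫⁻ z in {z | (∀ (n : ℕ) (hjn : j + 1 ≤ n) (hnK : n ≤ Ts), PlaqSmall (24 / 25 * θBal F.L γ b₀ p₀ n) (descendTo F ℰp n Ts hnK (Φ (V, z))))},
        (J (V, z) : ℝ≥0∞) ∂τ)
    -- (I-geo)sq, pair-local: CORNER STABILITY of the chart at every corner pair `(X, Xw)` of an admissible square (the (JV0-h)sq prefix VERBATIM, then ✓p815882's letter)
    (rc cS : ℝ) (hcS : cS < 1)
    (hstabSq : ∀ (B B' : PBond (F.P j) 0) (m m' : Fin 3 → ℝ) (U V W Y X Xw : GaugeField (F.P j) 0 ↥(Matrix.specialUnitaryGroup (Fin 2) ℂ)), ‖m‖ ≤ rc * (θBal F.L γ b₀ p₀ j / 4) → ‖m'‖ ≤ rc * (θBal F.L γ b₀ p₀ j / 4) → PlaqSmall (θBal F.L γ b₀ p₀ j / 4) U → PlaqSmall (θBal F.L γ b₀ p₀ j / 4) V → PlaqSmall (θBal F.L γ b₀ p₀ j / 4) W → PlaqSmall (θBal F.L γ b₀ p₀ j / 4) Y → PlaqSmall (θBal F.L γ b₀ p₀ j / 4) X → PlaqSmall (θBal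 F.L γ b₀ p₀ j / 4) Xw → (∀ e, e ≠ B → V e = U e) → V B = U B * expPt m → (∀ e, e ≠ B' → W e = U e) → W B' = U B' * expPt m' → (∀ e, e ≠ B' → Y e = V e) → Y B' = V B' * expPt m' → (X = U ∨ X = V ∨ X = W ∨ X = Y) → (Xw = U ∨ Xw = V ∨ Xw = W ∨ Xw = Y) → 
      ∀ z, mwCut F γ b₀ p₀ j Ts (Φ (Xw, z)) ≠ 0 → ∀ p, dist1 (GaugeField.plaqHol (Φ (X, z)) p) ≤ cS * θBal F.L γ b₀ p₀ Ts) :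
    ∀ t : ℝ, 0 ≤ t → t ≤ 1 → ∀ (B B' : PBond (F.P j) 0) (m m' : Fin 3 → ℝ) (U V W Y X Xw : GaugeField (F.P j) 0 ↥(Matrix.specialUnitaryGroup (Fin 2) ℂ)), ‖m‖ ≤ rc * (θBal F.L γ b₀ p₀ j / 4) → ‖m'‖ ≤ rc * (θBal F.L γ b₀ p₀ j / 4) → PlaqSmall (θBal F.L γ b₀ p₀ j / 4) U → PlaqSmall (θBal F.L γ b₀ p₀ j / 4) V → PlaqSmall (θBal F.L γ b₀ p₀ j / 4) W → PlaqSmall (θBal F.L γ b₀ p₀ j / 4) Y → PlaqSmall (θBal F.L γ b₀ p₀ j / 4) X → PlaqSmall (θBal F.L γ b₀ p₀ j / 4) Xw → (∀ e, e ≠ B → V e = U e) → V B = U B * expPt m → (∀ e, e ≠ B' → W e = U e) → W B' = U B' * expPt m' → (∀ e, e ≠ B' → Y e = V e) → Y B' = V B' * expPt m' → (X = U ∨ X = V ∨ X = W ∨ X = Y) → (Xw = U ∨ Xw = V ∨ Xw = W ∨ Xw = Y) → Integrable (fun z => (wgt F γ b₀ p₀ j Ts ρ ρ' τ Φ J t)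 Xw z) τ ∧ ∫ z, (wgt F γ b₀ p₀ j Ts ρ ρ' τ Φ J t) Xw z ∂τ = 1 ∧ Integrable (fun z => (Real.log (ρ Ts (Φ (X, z))) - Real.log (ρ' Ts (Φ (X, z)))) * (wgt F γ b₀ p₀ j Ts ρ ρ' τ Φ J t) Xw z) τ ∧ Integrable (fun z => (Real.log (ρ Ts (Φ (X, z))) - Real.log (ρ' Ts (Φ (X, z)))) ^ 2 * (wgt F γ b₀ p₀ j Ts ρ ρ' τ Φ J t) Xw z) τ := by
  intro t ht0 ht1 B B' m m' U V W Y X Xw hm hm' hU hV hW hY hX hXw hVU hVB hWU hWB hYV hYB hcorX hcorXw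
  have hXw1 : PlaqSmall (θBal F.L γ b₀ p₀ j) Xw := fun p => (hXw p).trans_le (by linarith [hθj.le])
  obtain ⟨-, -, hI, h1⟩ := wgt_normalised F γ b₀ p₀ j Ts hjTs ρ ρ' hρm hρ'm hρc hρ'c hρpos hθ hχc hχ0 hχsupp hχpos τ Φ J hΦm hJm CJ hJle hpos t Xw hXw1
  obtain ⟨i1, i2⟩ := integrable_logRatio_mul_wgt_of_squareStability F γ b₀ p₀ j Ts hjTs ρ ρ' hρm hρ'm hρc hρ'c hρpos hθ hχc hχ0 hχsupp hχpos
    τ Φ J hΦm hJm CJ hJle hpos cS hcS t X Xw hXw1 (hstabSq B B' m m' U V W Y X Xw hm hm' hU hV hW hY hX hXw hVU hVB hWU hWB hYV hYB hcorX hcorXw)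
  exact ⟨hI, h1, i1, i2⟩

/-- ★★ **JV0-sq FROM THE ROW's ONE-BOND LETTER** — the same (JV0-h)sq conjunct (text character-exact) with the corner-stability hypothesis DISCHARGED from the (I-geo)
one-bond displacement clause `hdisp` of `OrganDischargeInputsHJ` (✓p818968, text verbatim: `z` first, base in the `θ_j`-window, `‖v‖ ≤ rc·(θ_j∕4)`, `s ∈ Icc 0 1`), its uniform
cap `DP ≤ Db` and px20 g21's room₃ letter `24∕25·θBal_Ts + 3·(Db·rc) ≤ c·θBal_Ts`, by ONE call of ✓p819252 `hstab_corners_of_hdisp` — so the knit-sq's (JV0-h)sq line is ONE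
name over row-sq letters only. [folklore] -/
theorem jv0ClauseSq_of_hdisp (F : T3Family) (γ b₀ p₀ : ℝ) (j Ts : ℕ) (hjTs : j + 1 ≤ Ts)
    (ρ ρ' : (i : ℕ) → GaugeField (F.P i) 0 ↥(Matrix.specialUnitaryGroup (Fin 2) ℂ) → ℝ)
    (hρm : Measurable (ρ Ts)) (hρ'm : Measurable (ρ' Ts))
    (hρc : ContinuousOn (ρ Ts) {U | PlaqSmall (θBal F.L γ b₀ p₀ Ts) U}) (hρ'c : ContinuousOn (ρ' Ts) {U | PlaqSmall (θBal F.L γ b₀ p₀ Ts) U})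
    (hρpos : ∀ U, PlaqSmall (θBal F.L γ b₀ p₀ Ts) U → 0 < ρ Ts U ∧ 0 < ρ' Ts U)
    (hθ : 0 < θBal F.L γ b₀ p₀ Ts) (hθj : 0 < θBal F.L γ b₀ p₀ j)
    (hχc : Continuous (mwCut F γ b₀ p₀ j Ts)) (hχ0 : ∀ U, 0 ≤ mwCut F γ b₀ p₀ j Ts U)
    (hχsupp : ∀ U, mwCut F γ b₀ p₀ j Ts U ≠ 0 → ∀ (n : ℕ) (hjn : j + 1 ≤ n) (hnK : n ≤ Ts), PlaqSmall (24 / 25 * θBal F.L γ b₀ p₀ n) (descendTo F ℰp n Ts hnK U))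
    (hχpos : ∀ U, (∀ (n : ℕ) (hjn : j + 1 ≤ n) (hnK : n ≤ Ts), PlaqSmall (24 / 25 * θBal F.L γ b₀ p₀ n) (descendTo F ℰp n Ts hnK U)) → 0 < mwCut F γ b₀ p₀ j Ts U)
    {Z : Type} [MeasurableSpace Z] (τ : Measure Z) [IsProbabilityMeasure τ]
    (Φ : GaugeField (F.P j) 0 ↥(Matrix.specialUnitaryGroup (Fin 2) ℂ) × Z → GaugeField (F.P Ts) 0 ↥(Matrix.specialUnitaryGroup (Fin 2) ℂ))
    (J : GaugeField (F.P j) 0 ↥(Matrix.specialUnitaryGroup (Fin 2) ℂ) × Z → ℝ≥0)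
    (hΦm : Measurable Φ) (hJm : Measurable J) (CJ : ℝ) (hJle : ∀ V z, (J (V, z) : ℝ) ≤ CJ)
    (hpos : ∀ V, PlaqSmall (θBal F.L γ b₀ p₀ j) V →
      0 < ∫⁻ z in {z | (∀ (n : ℕ) (hjn : j + 1 ≤ n) (hnK : n ≤ Ts), PlaqSmall (24 / 25 * θBal F.L γ b₀ p₀ n) (descendTo F ℰp n Ts hnK (Φ (V, z))))},
        (J (V, z) : ℝ≥0∞) ∂τ)
    -- (I-geo)sq of the row: one-bond displacement letter `DP ≤ Db`, the clause `hdisp` VERBATIM, room₃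
    (c Db rc : ℝ) (hc : c < 1) (hrc0 : 0 ≤ rc) (hDb0 : 0 ≤ Db) (DP : Plaq (F.P Ts) 0 → PBond (F.P j) 0 → ℝ) (hDb : ∀ p b, DP p b ≤ Db)
    (hdisp : ∀ (z : Z) (X : GaugeField (F.P j) 0 ↥(Matrix.specialUnitaryGroup (Fin 2) ℂ)), PlaqSmall (θBal F.L γ b₀ p₀ j) X →
      ∀ (b : PBond (F.P j) 0) (v : Fin 3 → ℝ), ‖v‖ ≤ rc * (θBal F.L γ b₀ p₀ j / 4) → ∀ s ∈ Icc (0 : ℝ) 1, ∀ p : Plaq (F.P Ts) 0,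
        dist1 (GaugeField.plaqHol (Φ (update X b (X b * expPt (s • v)), z)) p)
          ≤ dist1 (GaugeField.plaqHol (Φ (X, z)) p) + DP p b * (‖v‖ / (θBal F.L γ b₀ p₀ j / 4)))
    (hroom : 24 / 25 * θBal F.L γ b₀ p₀ Ts + 3 * (Db * rc) ≤ c * θBal F.L γ b₀ p₀ Ts) :
    ∀ t : ℝ, 0 ≤ t → t ≤ 1 → ∀ (B B' : PBond (F.P j) 0) (m m' : Fin 3 → ℝ) (U V W Y X Xw : GaugeField (F.P j) 0 ↥(Matrix.specialUnitaryGroup (Fin 2) ℂ)), ‖m‖ ≤ rc * (θBal F.L γ b₀ p₀ j / 4) → ‖m'‖ ≤ rc * (θBal F.L γ b₀ p₀ j / 4) → PlaqSmall (θBal F.L γ b₀ p₀ j / 4) U → PlaqSmall (θBal F.L γ b₀ p₀ j / 4) V → PlaqSmall (θBal F.L γ b₀ p₀ j / 4) W → PlaqSmall (θBal F.L γ b₀ p₀ j / 4) Y → PlaqSmall (θBal F.L γ b₀ p₀ j / 4) X → PlaqSmall (θBal F.L γ b₀ p₀ j / 4) Xw → (∀ e, e ≠ B → V e = U e) → V B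 = U B * expPt m → (∀ e, e ≠ B' → W e = U e) → W B' = U B' * expPt m' → (∀ e, e ≠ B' → Y e = V e) → Y B' = V B' * expPt m' → (X = U ∨ X = V ∨ X = W ∨ X = Y) → (Xw = U ∨ Xw = V ∨ Xw = W ∨ Xw = Y) → Integrable (fun z => (wgt F γ b₀ p₀ j Ts ρ ρ' τ Φ J t) Xw z) τ ∧ ∫ z, (wgt F γ b₀ p₀ j Ts ρ ρ' τ Φ J t) Xw z ∂τ = 1 ∧ Integrable (fun z => (Real.log (ρ Ts (Φ (X, z))) - Real.log (ρ' Ts (Φ (X, z)))) * (wgt F γ b₀ p₀ j Ts ρ ρ' τ Φ J t) Xw z) τ ∧ Integrable (fun z => (Real.log (ρ Ts (Φ (X, z))) - Real.log (ρ' Ts (Φ (X, z)))) ^ 2 * (wgt F γ b₀ p₀ j Ts ρ ρ' τ Φ J t) Xw z) τ :=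
  jv0ClauseSq_of_cornerStability F γ b₀ p₀ j Ts hjTs ρ ρ' hρm hρ'm hρc hρ'c hρpos hθ hθj hχc hχ0 hχsupp hχpos τ Φ J hΦm hJm CJ hJle hpos rc c hc
    (fun B B' m m' U V W Y X Xw hm hm' hU hV hW hY _hX _hXw hVU hVB hWU hWB hYV hYB hcorX hcorXw z hz p =>
      hstab_corners_of_hdisp F γ b₀ p₀ j Ts hjTs hχsupp Φ hθj c Db rc hrc0 hDb0 DP hDb hdisp hroom z B B' m m' U V W Y hm hm' hU hV hW hY
        hVU hVB hWU hWB hYV hYB X Xw hcorX hcorXw hz p)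

end Summit.QuantumFields.YangMills.Theorems.OrganTangentJV0OfCornerStability

end
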